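import Summits.Ventures.YMGap.Thresholds.OneLinkFeedback
import HarnessLib

/-!
# Venture YMGap — the one-link modulus beyond first order, part 11: the CUBIC REMAINDER `c₃ = Γ(Re tr(·B), ψ₂)` as an
# explicit eight-term trace polynomial on `SU(N)`, and tangential derivatives see only restrictions

HONEST FRAMING: venture file of the cell `pub-ymgap` (QuantumFields programme), strong-coupling LATTICE bookkeeping for `SU(N)`
lattice Yang–Mills; nothing about the continuum or the mass gap in the Clay sense.  Pure matrix calculus («F5», part 2b-i, of the
cell note `HOME/p2/ONE-LINK-HIERARCHY.md` §3); no measure, no number of record.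

WHAT.  `ψ₂ = −κ_w Re tr(QΔQB) + κ_t Re(tr(QB)tr(QΔ)) − (1/(4N)) Re(tr(QB) conj tr(QΔ))` is the second-order Poisson solution
(`OneLinkCasimirTwo.lap_psiTwo_add_gam`); its cubic remainder `c₃ = Γ(Re tr(·B), ψ₂)` controls the Bakry–Émery term of the
second-order covariance bound (`OneLinkLevelTwoCovariance.cov_linear_le_levelTwo`).
* `matD_congr_su`, `Gam_self_congr_su`: if two smooth ambient functions agree on `SU(N)`, their derivatives along `𝔰𝔲(N)` and
  their carrés du champ agree on `SU(N)` (the flow `g·exp(tY)` stays in `SU(N)`).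
* `Gam_smul_right'`: `Γ(F, r•G) = r Γ(F, G)`.
* `gam_potB_psiTwo_eq` (THE DECOMPOSITION): on `SU(N)`, `c₃(g)` equals the explicit polynomial
  `T_a + T_b + T_c + T_d1 + T_d2 + T_d3 + T_d4 + T_d5` of the cell note §3 — two cubic words, two linear words, and the products
  `Im tr(gB)·Im tr(gΔgB)`, `Re(tr(gBgB)·η₂)`, `Re(tr(gΔgB)·η₁)`, `Re(tr(gΔ)·ζ_B)`, `Re(tr(gB)·ζ_τ)`, `Im tr(gB)·Im(tr(gB)tr(gΔ))`
  (`η_i = κ_t z_i − conj z_i/(4N)`), all written with `Q` in front so that the tree's derivative lemmas apply verbatim.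
The identity is the three feedback rules of `OneLinkFeedback` combined linearly; it was checked numerically on `SU(3…6)`
(cell folder `HOME/p2/hier/alg_check.py` (C7), residual 1e-13) before being proved here.

References: cell note `HOME/p2/ONE-LINK-HIERARCHY.md` §2.3, §3; Bröcker–tom Dieck GTM 98 II.5.
-/

noncomputable section

open scoped Matrix ComplexConjugate BigOperators
open Matrix Complex Finset
open Literature.MathematicalPhysics.QuantumFieldTheory
open Literature.MathematicalPhysics.QuantumFieldTheory.SUNBakryEmery

namespace Summit.Ventures.YMGap.OneLinkEigen

variable {N : ℕ}

section Calc

open scoped Matrix.Norms.Frobenius ContDiff Topology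

/-! ### Tangential derivatives on `SU(N)` see only the restriction -/

/-- If two smooth ambient functions agree on `SU(N)`, their derivatives along any `Y ∈ 𝔰𝔲(N)` agree on `SU(N)`
(the curve `s ↦ g·exp(sY)` stays in `SU(N)`). [folklore] -/
theorem matD_congr_su {F G : Matrix (Fin N) (Fin N) ℂ → ℝ} (hF : ContDiff ℝ ∞ F) (hG : ContDiff ℝ ∞ G)
    (h : ∀ g : SUN N, F g = G g) {Y : Matrix (Fin N) (Fin N) ℂ} (hY : Yᴴ = -Y) (hY0 : Y.trace = 0) (g : SUN N) :
    matD Y F g = matD Y G g := by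
  have h1 := hasDerivAt_comp_mul_exp hF (g : Matrix (Fin N) (Fin N) ℂ) Y 0
  have h2 := hasDerivAt_comp_mul_exp hG (g : Matrix (Fin N) (Fin N) ℂ) Y 0
  rw [zero_smul, NormedSpace.exp_zero, Matrix.mul_one] at h1 h2
  have heq : (fun s : ℝ => F ((g : Matrix (Fin N) (Fin N) ℂ) * NormedSpace.exp (s • Y))) =
      fun s : ℝ => G ((g : Matrix (Fin N) (Fin N) ℂ) * NormedSpace.exp (s • Y)) := by
    funext s
    have e : (g : Matrix (Fin N) (Fin N) ℂ) * NormedSpace.exp (s • Y) = ((g * expSU hY hY0 s : SUN N) : Matrix (Fin N) (Fin N) ℂ) := by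
      rw [Submonoid.coe_mul, coe_expSU]
    rw [e, h]
  -- restate in the local instance context (definitionally equal topologies), then compare derivatives
  have h1' : HasDerivAt (fun s : ℝ => F ((g : Matrix (Fin N) (Fin N) ℂ) * NormedSpace.exp (s • Y))) (matD Y F g) 0 := h1
  have h2' : HasDerivAt (fun s : ℝ => G ((g : Matrix (Fin N) (Fin N) ℂ) * NormedSpace.exp (s • Y))) (matD Y G g) 0 := h2
  rw [heq] at h1'
  exact h1'.unique h2'

/-- `Γ(F, F) = Γ(G, G)` on `SU(N)` whenever the smooth `F, G` agree on `SU(N)`. [folklore] -/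
theorem Gam_self_congr_su (hN : N ≠ 0) {F G : Matrix (Fin N) (Fin N) ℂ → ℝ} (hF : ContDiff ℝ ∞ F) (hG : ContDiff ℝ ∞ G)
    (h : ∀ g : SUN N, F g = G g) (g : SUN N) : Gam F F g = Gam G G g := by
  simp only [Gam]
  refine sum_congr rfl fun α _ => ?_
  rw [matD_congr_su hF hG h (frame_conjTranspose α) (frame_trace hN α) g]

/-- `Γ(F, r • G) = r Γ(F, G)` for smooth `G`. [folklore] -/
theorem Gam_smul_right' (F : Matrix (Fin N) (Fin N) ℂ → ℝ) (r : ℝ) {G : Matrix (Fin N) (Fin N) ℂ → ℝ} (hG : ContDiff ℝ ∞ G)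
    (Q : Matrix (Fin N) (Fin N) ℂ) : Gam F (r • G) Q = r * Gam F G Q := by
  simp only [Gam, mul_sum]
  refine sum_congr rfl fun α _ => ?_
  have : matD (frame α) (r • G) = fun Q => r * matD (frame α) G Q := matD_const_mul hG r _
  rw [this]; ring

/-! ### Trace bookkeeping -/

/-- `tr(B g M g) = tr(g M g B)`. [folklore] -/
theorem trace_BgMg (B M Q : Matrix (Fin N) (Fin N) ℂ) : (B * Q * M * Q).trace = (Q * M * Q * B).trace := by
  rw [show B * Q * M * Q = B * (Q * M * Q) by simp only [Matrix.mul_assoc], trace_mul_comm]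

/-- `tr(B g M₁ g M₂ g) = tr(g B g M₁ g M₂)`. [folklore] -/
theorem trace_BgMgMg (B M₁ M₂ Q : Matrix (Fin N) (Fin N) ℂ) :
    (B * Q * M₁ * Q * M₂ * Q).trace = (Q * B * Q * M₁ * Q * M₂).trace := by
  rw [trace_mul_comm (B * Q * M₁ * Q * M₂) Q]
  simp only [Matrix.mul_assoc]

/-! ### The decomposition of the cubic remainder -/

/-- **THE CUBIC REMAINDER IN CLOSED FORM.**  For `N ≥ 3`, on `SU(N)`, with `κ_w = N²/(4(N²−4))`, `κ_t = N/(2(N²−4))`,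
`c = 1/(4N)`, `z₁ = tr(gB)`, `z₂ = tr(gΔ)`, `w = tr(gΔgB)`, `w_BB = tr(gBgB)`, `ζ_B = tr(BBᴴ)`, `τ = tr(ΔBᴴ)`, `X = Im z₁`:
`Γ(Re tr(·B), ψ₂)(g) = (κ_w/2)[Re tr(gBgΔgB) + Re tr(gBgBgΔ)] − (κ_w/2)[Re tr(gBBᴴΔ) + Re tr(gΔBᴴB)] + (2κ_w/N) X Im w
  − ½Re[w_BB(κ_t z₂ − c conj z₂)] − ½Re[w(κ_t z₁ − c conj z₁)] + ½Re[z₂(κ_t ζ_B − c conj ζ_B)] + ½Re[z₁(κ_t τ − c conj τ)]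
  − (2κ_t/N) X Im(z₁z₂)`. [folklore] -/
theorem gam_potB_psiTwo_eq (hN : 3 ≤ N) (B Δ : Matrix (Fin N) (Fin N) ℂ) (g : SUN N) :
    Gam (pot 1 B) (fun Q : Matrix (Fin N) (Fin N) ℂ =>
        -((N : ℝ) ^ 2 / (4 * ((N : ℝ) ^ 2 - 4))) * (Q * Δ * Q * B).trace.re
          + ((N : ℝ) / (2 * ((N : ℝ) ^ 2 - 4))) * ((Q * B).trace * (Q * Δ).trace).re
          - (1 / (4 * (N : ℝ))) * ((Q * B).trace * (starRingEnd ℂ) (Q * Δ).trace).re) g =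
      ((N : ℝ) ^ 2 / (4 * ((N : ℝ) ^ 2 - 4))) / 2 *
          (((g : Matrix (Fin N) (Fin N) ℂ) * B * g * Δ * g * B).trace.re + ((g : Matrix (Fin N) (Fin N) ℂ) * B * g * B * g * Δ).trace.re)
        - ((N : ℝ) ^ 2 / (4 * ((N : ℝ) ^ 2 - 4))) / 2 *
          (((g : Matrix (Fin N) (Fin N) ℂ) * (B * Bᴴ * Δ)).trace.re + ((g : Matrix (Fin N) (Fin N) ℂ) * (Δ * Bᴴ * B)).trace.re)
        + 2 * ((N : ℝ) ^ 2 / (4 * ((N : ℝ) ^ 2 - 4))) / N *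
          ((g : Matrix (Fin N) (Fin N) ℂ) * B).trace.im * ((g : Matrix (Fin N) (Fin N) ℂ) * Δ * g * B).trace.im
        - 1 / 2 * (((g : Matrix (Fin N) (Fin N) ℂ) * B * g * B).trace *
            ((((N : ℝ) / (2 * ((N : ℝ) ^ 2 - 4)) : ℝ) : ℂ) * ((g : Matrix (Fin N) (Fin N) ℂ) * Δ).trace
              - ((1 / (4 * (N : ℝ)) : ℝ) : ℂ) * (starRingEnd ℂ) ((g : Matrix (Fin N) (Fin N) ℂ) * Δ).trace)).re
        - 1 / 2 * (((g : Matrix (Fin N) (Fin N) ℂ) * Δ * g * B).trace *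
            ((((N : ℝ) / (2 * ((N : ℝ) ^ 2 - 4)) : ℝ) : ℂ) * ((g : Matrix (Fin N) (Fin N) ℂ) * B).trace
              - ((1 / (4 * (N : ℝ)) : ℝ) : ℂ) * (starRingEnd ℂ) ((g : Matrix (Fin N) (Fin N) ℂ) * B).trace)).re
        + 1 / 2 * (((g : Matrix (Fin N) (Fin N) ℂ) * Δ).trace *
            ((((N : ℝ) / (2 * ((N : ℝ) ^ 2 - 4)) : ℝ) : ℂ) * (B * Bᴴ).trace
              - ((1 / (4 * (N : ℝ)) : ℝ) : ℂ) * (starRingEnd ℂ) (B * Bᴴ).trace)).re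
        + 1 / 2 * (((g : Matrix (Fin N) (Fin N) ℂ) * B).trace *
            ((((N : ℝ) / (2 * ((N : ℝ) ^ 2 - 4)) : ℝ) : ℂ) * (Δ * Bᴴ).trace
              - ((1 / (4 * (N : ℝ)) : ℝ) : ℂ) * (starRingEnd ℂ) (Δ * Bᴴ).trace)).re
        - 2 * ((N : ℝ) / (2 * ((N : ℝ) ^ 2 - 4))) / N *
          ((g : Matrix (Fin N) (Fin N) ℂ) * B).trace.im *
            (((g : Matrix (Fin N) (Fin N) ℂ) * B).trace * ((g : Matrix (Fin N) (Fin N) ℂ) * Δ).trace).im := by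
  have hN0 : N ≠ 0 := by omega
  have hNr : (N : ℝ) ≠ 0 := by exact_mod_cast hN0
  set κw : ℝ := (N : ℝ) ^ 2 / (4 * ((N : ℝ) ^ 2 - 4)) with hκw
  set κt : ℝ := (N : ℝ) / (2 * ((N : ℝ) ^ 2 - 4)) with hκt
  set c : ℝ := 1 / (4 * (N : ℝ)) with hc
  -- split `ψ₂` into its three smooth pieces
  have hdec : (fun Q : Matrix (Fin N) (Fin N) ℂ =>
        -κw * (Q * Δ * Q * B).trace.re + κt * ((Q * B).trace * (Q * Δ).trace).re
          - c * ((Q * B).trace * (starRingEnd ℂ) (Q * Δ).trace).re) =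
      (-κw) • (fun Q : Matrix (Fin N) (Fin N) ℂ => (Q * Δ * Q * B).trace.re)
        + (κt • (fun Q : Matrix (Fin N) (Fin N) ℂ => ((Q * B).trace * (Q * Δ).trace).re)
          + (-c) • fun Q : Matrix (Fin N) (Fin N) ℂ => ((Q * B).trace * (starRingEnd ℂ) (Q * Δ).trace).re) := by
    funext Q; simp only [Pi.add_apply, Pi.smul_apply, smul_eq_mul]; ring
  have hq := contDiff_reTrQuad (N := N) Δ B
  have hp := contDiff_reTrProd (N := N) B Δ
  have hs := contDiff_reTrProdConj (N := N) B Δ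
  have h1 : ContDiff ℝ ∞ ((-κw) • fun Q : Matrix (Fin N) (Fin N) ℂ => (Q * Δ * Q * B).trace.re) := by
    have h := hq.const_smul (-κw); exact h
  have h2 : ContDiff ℝ ∞ (κt • fun Q : Matrix (Fin N) (Fin N) ℂ => ((Q * B).trace * (Q * Δ).trace).re) := by
    have h := hp.const_smul κt; exact h
  have h3 : ContDiff ℝ ∞ ((-c) • fun Q : Matrix (Fin N) (Fin N) ℂ => ((Q * B).trace * (starRingEnd ℂ) (Q * Δ).trace).re) := by
    have h := hs.const_smul (-c); exact h
  have h23 : ContDiff ℝ ∞ ((κt • fun Q : Matrix (Fin N) (Fin N) ℂ => ((Q * B).trace * (Q * Δ).trace).re)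
      + (-c) • fun Q : Matrix (Fin N) (Fin N) ℂ => ((Q * B).trace * (starRingEnd ℂ) (Q * Δ).trace).re) := h2.add h3
  rw [hdec, Gam_add_right _ h1 h23, Gam_add_right _ h2 h3, Gam_smul_right' _ _ hq, Gam_smul_right' _ _ hp,
    Gam_smul_right' _ _ hs, Gam_potB_reTrQuad hN0 B Δ B g, Gam_potB_reTrProd hN0 B B Δ g,
    Gam_potB_reTrProdConj hN0 B B Δ g]
  -- bring every trace atom to the `Q`-first shape
  set Q : Matrix (Fin N) (Fin N) ℂ := (g : Matrix (Fin N) (Fin N) ℂ) with hQ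
  have e1 : (B * Q * Δ * Q * B * Q).trace.re = (Q * B * Q * Δ * Q * B).trace.re := by rw [trace_BgMgMg]
  have e2 : (B * Q * B * Q * Δ * Q).trace.re = (Q * B * Q * B * Q * Δ).trace.re := by rw [trace_BgMgMg]
  have e3 : (B * Q).trace = (Q * B).trace := trace_mul_comm _ _
  have e4 : (B * Q * B * Q).trace = (Q * B * Q * B).trace := trace_BgMg _ _ _
  have e5 : (B * Q * Δ * Q).trace = (Q * Δ * Q * B).trace := trace_BgMg _ _ _
  have e6 : (Q * B * Bᴴ * Δ).trace.re = (Q * (B * Bᴴ * Δ)).trace.re := by simp only [Matrix.mul_assoc]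
  have e7 : (Q * Δ * Bᴴ * B).trace.re = (Q * (Δ * Bᴴ * B)).trace.re := by simp only [Matrix.mul_assoc]
  rw [e1, e2, e3, e4, e5, e6, e7]
  have hc1 : ((κt : ℝ) : ℂ).re = κt := Complex.ofReal_re _
  have hc2 : ((κt : ℝ) : ℂ).im = 0 := Complex.ofReal_im _
  have hc3 : ((c : ℝ) : ℂ).re = c := Complex.ofReal_re _
  have hc4 : ((c : ℝ) : ℂ).im = 0 := Complex.ofReal_im _
  simp only [mul_re, mul_im, sub_re, sub_im, conj_re, conj_im, hc1, hc2, hc3, hc4]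
  field_simp
  ring

end Calc

end Summit.Ventures.YMGap.OneLinkEigen
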